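import Summits.AnomalousDissipation.AnomalousDissipation.Theorems.TwodBoundedEnergyZeroMomentum.Negative.ShellPincerGalerkin
import Summits.AnomalousDissipation.AnomalousDissipation.Theorems.TwodBoundedEnergyZeroMomentum.Negative.FirstShellTrilinear
import Literature.Analysis.FluidPDE.LongTimeAverageSubadditive
import Literature.Analysis.FluidPDE.LongTimeAverageNonneg
import Literature.Analysis.FluidPDE.TimeAverageEnstrophy
import Literature.Analysis.FluidPDE.DoeringFoiasPowerProofs
import Mathlib.Analysis.SpecialFunctions.ImproperIntegrals

/-!
# The single-shell pincer for every Leray–Hopf solution, III: every solution, long-time form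
(negative-side support for the crux `TwoAndHalfD.TwodBoundedEnergyZeroMomentum`, cdisprove seat
`refuter-cdisprove-stmt-AnomalousDissipation-10786-g2-0`, gen 2, cycle 2)

Main results (Kolmogorov-type forcing on ONE Fourier shell `|k|² = m`, any level `m > 0`):

* `shellPincer_of_singleShell` — for EVERY global Leray–Hopf solution `u` from `L²` data,
  `‖∇u(t)‖₂² ≤ 4π²m‖u(t)‖₂² + K e^{-8π²mν(t-1)}` for all `t ≥ 1` (2-D uniqueness transfers the
  bound of `exists_lerayHopf_shellPincer`; Tran–Shepherd 2002 §4, CTV 2013 §2 (diffeq)–(enst)).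
* `longTimeAvgSup_enstrophy_le_of_singleShell` — `⟨‖∇u‖₂²⟩ ≤ 4π²m ⟨‖u‖₂²⟩` (limsup Cesàro means).
* `meanDissipation_le_of_singleShell` — `ε = ⟨ν‖∇u‖₂²⟩ ≤ 4π²mν ⟨‖u‖₂²⟩`.
* crux form: `witness_meanDissipation_le_of_singleShell` — along any family as in the crux body
  driven by a single-shell `g`, `ε_j ≤ 4π²m ν_j E → 0`: a single-shell witness of
  `TwodBoundedEnergyZeroMomentum` is quasi-laminar in `H¹` (mean enstrophy `≤ 4π²mE/…` uniformly
  in `j`) and its planar dissipation vanishes like `ν_j` — the Lean half of the route's design rule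
  "the planar force must span at least two shells" (the scalar half is DiPerna–Lions, on paper in
  `Literature/Barriers/AnomalousDissipation/GravestModeLaminarAttractorTimePincer`).
-/

noncomputable section

open MeasureTheory Set Filter Topology UnitAddTorus
open scoped ENNReal NNReal InnerProductSpace

namespace Summit.AnomalousDissipation.AnomalousDissipation.Theorems.TwodBoundedEnergyZeroMomentum.Negative

open Literature.Analysis.FunctionSpaces Literature.Analysis.FunctionSpaces.Torus
open Literature.Analysis.FluidPDE Literature.Analysis.FluidPDE.Torus

section EveryLH

variable {ν : ℝ} {g u₀ : UnitAddTorus (Fin 2) → EuclideanSpace ℝ (Fin 2)}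
  {u : ℝ → UnitAddTorus (Fin 2) → EuclideanSpace ℝ (Fin 2)}

/-- **The single-shell pincer for EVERY Leray–Hopf solution.** Let `g` be smooth with Fourier
support on the shell `|k|² = m`, `m > 0`, `ν > 0`, `u₀ ∈ L²`, and let `u` be ANY global Leray–Hopf
solution of the Navier–Stokes equations on `𝕋²` driven by `g`. Then for some `K ≥ 0` and all
`t ≥ 1`, `‖∇u(t)‖₂² ≤ 4π²m‖u(t)‖₂² + K e^{-8π²mν(t-1)}` (the solution is the Galerkin-limit one by
2-D weak–strong uniqueness; Tran–Shepherd 2002 §4, CTV 2013 §2 (diffeq)–(enst) for smooth data). [cite: ConstantinTarfuleaVicol2013, §2 (diffeq)–(enst)] -/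
theorem shellPincer_of_singleShell (hν : 0 < ν) (hg : IsSmooth g) {m : ℝ} (hm : 0 < m)
    (hg1 : ∀ k : Fin 2 → ℤ, freqNormSq k ≠ m → mFourierCoeff (EuclideanSpace.complexify ∘ g) k = 0)
    (hu₀ : MemLp u₀ 2 volume) (hu : IsGlobalLerayHopf ν (fun _ => g) u₀ u) :
    ∃ K : ℝ, 0 ≤ K ∧ ∀ t, 1 ≤ t →
      eGradNormSq (u t) ≤ ENNReal.ofReal (4 * Real.pi ^ 2 * m * (∫ x, ‖u t x‖ ^ 2) +
        K * Real.exp (-(8 * Real.pi ^ 2 * m * ν) * (t - 1))) := by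
  obtain ⟨w, hw, K, hK0, hKw⟩ := exists_lerayHopf_shellPincer hg hm hg1 hν hu₀ hu.isWeaklyDivFree_datum
  have hfm : AEStronglyMeasurable (stLift fun _ : ℝ => g) (volume.restrict (Ioi 0 ×ˢ univ)) :=
    aestronglyMeasurable_stLift_steady hg.continuous _
  have hf₂ : ∀ T : ℝ, 0 < T → ∫⁻ _ in Ioo 0 T, ∫⁻ x, ‖g x‖ₑ ^ 2 < ⊤ := fun T _ =>
    lintegral_Ioo_lintegral_enorm_sq_steady_lt_top (hg.memLp 2) T
  have hae : ∀ t, 0 < t → u t =ᵐ[volume] w t := fun t ht =>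
    lions_prodi_uniqueness_torus2_holds.global hν hfm hf₂ hu₀ hu.isWeaklyDivFree_datum hu hw ht
  refine ⟨K, hK0, fun t ht => ?_⟩
  have ht0 : 0 < t := one_pos.trans_le ht
  have h1 : eGradNormSq (u t) = eGradNormSq (w t) := by
    rw [eGradNormSq_eq_tsum, eGradNormSq_eq_tsum]
    congr 1
    refine tsum_congr fun k => ?_
    rw [mFourierCoeff_congr_ae ((hae t ht0).fun_comp EuclideanSpace.complexify) k]
  have h2 : ∫ x, ‖u t x‖ ^ 2 = ∫ x, ‖w t x‖ ^ 2 := by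
    refine integral_congr_ae ?_
    filter_upwards [hae t ht0] with x hx
    rw [hx]
  rw [h1, h2]
  exact hKw t ht

/-- **Dynamically, a condensate is necessary** (every Leray–Hopf solution, single-shell force at
level `m`): for `t ≥ 1` the weighted super-shell energy is at most the weighted sub-shell energy
plus the transient, `∑_{|k|²>m} 4π²(|k|²-m)‖û(t,k)‖² ≤ ∑_{|k|²<m} 4π²(m-|k|²)‖û(t,k)‖² + K e^{-8π²mν(t-1)}`
— the time-dependent form of the steady straddle (`steady_hasSum_straddle`): energy above the
forcing shell must be paid for by energy BELOW it, at every late time. [cite: ConstantinTarfuleaVicol2013, §2 (enst)] -/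
theorem shellPlus_le_shellMinus_of_singleShell (hν : 0 < ν) (hg : IsSmooth g) {m : ℝ} (hm : 0 < m)
    (hg1 : ∀ k : Fin 2 → ℤ, freqNormSq k ≠ m → mFourierCoeff (EuclideanSpace.complexify ∘ g) k = 0)
    (hu₀ : MemLp u₀ 2 volume) (hu : IsGlobalLerayHopf ν (fun _ => g) u₀ u) :
    ∃ K : ℝ, 0 ≤ K ∧ ∀ t, 1 ≤ t →
      (∑' k : Fin 2 → ℤ, ENNReal.ofReal (4 * Real.pi ^ 2 * (freqNormSq k - m)) *
          ‖mFourierCoeff (EuclideanSpace.complexify ∘ u t) k‖ₑ ^ 2) ≤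
        (∑' k : Fin 2 → ℤ, ENNReal.ofReal (4 * Real.pi ^ 2 * (m - freqNormSq k)) *
          ‖mFourierCoeff (EuclideanSpace.complexify ∘ u t) k‖ₑ ^ 2) +
          ENNReal.ofReal (K * Real.exp (-(8 * Real.pi ^ 2 * m * ν) * (t - 1))) := by
  obtain ⟨K, hK0, hK⟩ := shellPincer_of_singleShell hν hg hm hg1 hu₀ hu
  refine ⟨K, hK0, fun t ht => ?_⟩
  have ht0 : 0 ≤ t := zero_le_one.trans ht
  have hut : MemLp (u t) 2 volume := hu.memLp_two ht0
  have hid := eGradNormSq_add_shellMinus_eq m hm.le (u t)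
  have hpars : ∑' k : Fin 2 → ℤ, ‖mFourierCoeff (EuclideanSpace.complexify ∘ u t) k‖ₑ ^ 2 =
      ENNReal.ofReal (∫ x, ‖u t x‖ ^ 2) := by
    rw [Torus.tsum_enorm_sq_mFourierCoeff_complexify hut, Torus.lintegral_enorm_sq_eq_ofReal hut]
  have hE : 0 ≤ ∫ x, ‖u t x‖ ^ 2 := integral_nonneg fun _ => sq_nonneg _
  have hr : 0 ≤ K * Real.exp (-(8 * Real.pi ^ 2 * m * ν) * (t - 1)) := by positivity
  have hΛE : ENNReal.ofReal (4 * Real.pi ^ 2 * m) * ENNReal.ofReal (∫ x, ‖u t x‖ ^ 2) ≠ ⊤ :=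
    ENNReal.mul_ne_top ENNReal.ofReal_ne_top ENNReal.ofReal_ne_top
  -- `Φ⁺ + Λ|u|² = ‖∇u‖² + Φ⁻ ≤ (Λ|u|² + r) + Φ⁻`
  have h1 : (∑' k : Fin 2 → ℤ, ENNReal.ofReal (4 * Real.pi ^ 2 * (freqNormSq k - m)) *
        ‖mFourierCoeff (EuclideanSpace.complexify ∘ u t) k‖ₑ ^ 2) +
      ENNReal.ofReal (4 * Real.pi ^ 2 * m) * ENNReal.ofReal (∫ x, ‖u t x‖ ^ 2) ≤
      ((∑' k : Fin 2 → ℤ, ENNReal.ofReal (4 * Real.pi ^ 2 * (m - freqNormSq k)) *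
        ‖mFourierCoeff (EuclideanSpace.complexify ∘ u t) k‖ₑ ^ 2) +
        ENNReal.ofReal (K * Real.exp (-(8 * Real.pi ^ 2 * m * ν) * (t - 1)))) +
      ENNReal.ofReal (4 * Real.pi ^ 2 * m) * ENNReal.ofReal (∫ x, ‖u t x‖ ^ 2) := by
    rw [← hpars, ← hid]
    calc eGradNormSq (u t) + _ ≤ ENNReal.ofReal (4 * Real.pi ^ 2 * m * (∫ x, ‖u t x‖ ^ 2) +
          K * Real.exp (-(8 * Real.pi ^ 2 * m * ν) * (t - 1))) + _ := add_le_add (hK t ht) le_rfl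
      _ = _ := by
          rw [ENNReal.ofReal_add (by positivity) hr, ENNReal.ofReal_mul (by positivity), hpars]
          ring
  exact (ENNReal.add_le_add_iff_right hΛE).1 h1

/-- Real form of the pincer: `(‖∇u(t)‖₂²).toReal ≤ 4π²m‖u(t)‖₂² + K e^{8π²mν} e^{-8π²mν t}` for
`t ≥ 1`. [folklore] -/
theorem toReal_eGradNormSq_le_of_singleShell (hν : 0 < ν) (hg : IsSmooth g) {m : ℝ} (hm : 0 < m)
    (hg1 : ∀ k : Fin 2 → ℤ, freqNormSq k ≠ m → mFourierCoeff (EuclideanSpace.complexify ∘ g) k = 0)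
    (hu₀ : MemLp u₀ 2 volume) (hu : IsGlobalLerayHopf ν (fun _ => g) u₀ u) :
    ∃ K : ℝ, 0 ≤ K ∧ ∀ t, 1 ≤ t →
      (eGradNormSq (u t)).toReal ≤ 4 * Real.pi ^ 2 * m * (∫ x, ‖u t x‖ ^ 2) +
        K * Real.exp (8 * Real.pi ^ 2 * m * ν) * Real.exp (-(8 * Real.pi ^ 2 * m * ν) * t) := by
  obtain ⟨K, hK0, hK⟩ := shellPincer_of_singleShell hν hg hm hg1 hu₀ hu
  refine ⟨K, hK0, fun t ht => ?_⟩
  have hE : 0 ≤ ∫ x, ‖u t x‖ ^ 2 := integral_nonneg fun _ => sq_nonneg _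
  have hexp : K * Real.exp (-(8 * Real.pi ^ 2 * m * ν) * (t - 1)) =
      K * Real.exp (8 * Real.pi ^ 2 * m * ν) * Real.exp (-(8 * Real.pi ^ 2 * m * ν) * t) := by
    rw [mul_assoc K, ← Real.exp_add]
    congr 1
    ring
  have h := ENNReal.toReal_le_of_le_ofReal (by positivity) (hK t ht)
  rwa [hexp] at h

end EveryLH

/-! ### Long-time averages -/

section LongTime

variable {ν : ℝ} {g u₀ : UnitAddTorus (Fin 2) → EuclideanSpace ℝ (Fin 2)}
  {u : ℝ → UnitAddTorus (Fin 2) → EuclideanSpace ℝ (Fin 2)}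

/-- Running means of `t ↦ C e^{-c t}` (`C ≥ 0`, `c > 0`) are at most `C/(cT)`, so they tend to zero
and are eventually bounded. [folklore] -/
theorem timeMean_exp_le {C c : ℝ} (hC : 0 ≤ C) (hc : 0 < c) {T : ℝ} (hT : 0 < T) :
    timeMean (fun t => C * Real.exp (-c * t)) T ≤ C / c * T⁻¹ := by
  unfold timeMean
  rw [intervalIntegral.integral_of_le hT.le]
  have hint : IntegrableOn (fun t => C * Real.exp (-c * t)) (Ioi (0 : ℝ)) :=
    (integrableOn_exp_mul_Ioi (neg_lt_zero.2 hc) 0).const_mul C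
  have h1 : ∫ t in Ioc 0 T, C * Real.exp (-c * t) ≤ ∫ t in Ioi (0 : ℝ), C * Real.exp (-c * t) :=
    setIntegral_mono_set hint (ae_of_all _ fun t => by positivity) (ae_of_all _ Ioc_subset_Ioi_self)
  have h2 : ∫ t in Ioi (0 : ℝ), C * Real.exp (-c * t) = C / c := by
    rw [integral_const_mul, integral_exp_mul_Ioi (neg_lt_zero.2 hc) 0]
    simp only [mul_zero, Real.exp_zero]
    field_simp
  rw [h2] at h1
  calc T⁻¹ * ∫ t in Ioc 0 T, C * Real.exp (-c * t) ≤ T⁻¹ * (C / c) :=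
        mul_le_mul_of_nonneg_left h1 (inv_nonneg.2 hT.le)
    _ = C / c * T⁻¹ := by ring

/-- `⟨C e^{-ct}⟩ = 0`. [folklore] -/
theorem longTimeAvgSup_exp_eq_zero {C c : ℝ} (hC : 0 ≤ C) (hc : 0 < c) :
    longTimeAvgSup (fun t => C * Real.exp (-c * t)) = 0 := by
  have h0 : ∀ t, 0 ≤ C * Real.exp (-c * t) := fun t => by positivity
  have htend : Tendsto (timeMean fun t => C * Real.exp (-c * t)) atTop (𝓝 0) := by
    have hup : Tendsto (fun T : ℝ => C / c * T⁻¹) atTop (𝓝 0) := by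
      simpa using tendsto_inv_atTop_zero.const_mul (C / c)
    refine tendsto_of_tendsto_of_tendsto_of_le_of_le' tendsto_const_nhds hup ?_ ?_
    · filter_upwards [eventually_gt_atTop (0 : ℝ)] with T hT using timeMean_nonneg h0 hT.le
    · filter_upwards [eventually_gt_atTop (0 : ℝ)] with T hT using timeMean_exp_le hC hc hT
  exact htend.limsup_eq

/-- Running means of the early-time part `𝟙_{t<1}·φ(t)` of a nonnegative locally integrable
observable are at most `(∫₀¹ φ)/T`, so `⟨𝟙_{t<1} φ⟩ = 0`. [folklore] -/
theorem longTimeAvgSup_indicator_Iio_one_eq_zero {φ : ℝ → ℝ} (h0 : ∀ t, 0 ≤ φ t)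
    (hφ : IntegrableOn φ (Ioc 0 1)) :
    longTimeAvgSup ((Iio (1 : ℝ)).indicator φ) = 0 := by
  have hi0 : ∀ t, 0 ≤ (Iio (1 : ℝ)).indicator φ t := fun t =>
    Set.indicator_nonneg (fun s _ => h0 s) t
  set D : ℝ := ∫ t in Ioc 0 1, φ t with hD
  have hD0 : 0 ≤ D := setIntegral_nonneg measurableSet_Ioc fun t _ => h0 t
  have hmean : ∀ T, 1 ≤ T → timeMean ((Iio (1 : ℝ)).indicator φ) T ≤ D * T⁻¹ := by
    intro T hT
    have hT0 : 0 < T := one_pos.trans_le hT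
    unfold timeMean
    rw [intervalIntegral.integral_of_le hT0.le, setIntegral_indicator measurableSet_Iio]
    have hsub : Ioc 0 T ∩ Iio 1 ⊆ Ioc 0 1 := fun t ht => ⟨ht.1.1, le_of_lt ht.2⟩
    have h1 : ∫ t in Ioc 0 T ∩ Iio 1, φ t ≤ D :=
      setIntegral_mono_set hφ (ae_of_all _ fun t => h0 t) (ae_of_all _ hsub)
    calc T⁻¹ * ∫ t in Ioc 0 T ∩ Iio 1, φ t ≤ T⁻¹ * D := mul_le_mul_of_nonneg_left h1 (inv_nonneg.2 hT0.le)
      _ = D * T⁻¹ := by ring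
  have htend : Tendsto (timeMean ((Iio (1 : ℝ)).indicator φ)) atTop (𝓝 0) := by
    have hup : Tendsto (fun T : ℝ => D * T⁻¹) atTop (𝓝 0) := by
      simpa using tendsto_inv_atTop_zero.const_mul D
    refine tendsto_of_tendsto_of_tendsto_of_le_of_le' tendsto_const_nhds hup ?_ ?_
    · filter_upwards [eventually_gt_atTop (0 : ℝ)] with T hT using timeMean_nonneg hi0 hT.le
    · filter_upwards [eventually_ge_atTop (1 : ℝ)] with T hT using hmean T hT
  exact htend.limsup_eq

/-- **Tran–Shepherd / CTV constraint in the mean, for every Leray–Hopf solution**: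
`⟨‖∇u‖₂²⟩ ≤ 4π²m ⟨‖u‖₂²⟩` under a single-shell force at level `m` (limsup Cesàro means; zero-mean
smooth force so that the energy means are honest, Doering–Foias 2002 §2). [cite: ConstantinTarfuleaVicol2013, §2 (enst)] -/
theorem longTimeAvgSup_enstrophy_le_of_singleShell (hν : 0 < ν) (hg : IsSmooth g) (hgm : HasZeroMean g)
    {m : ℝ} (hm : 0 < m)
    (hg1 : ∀ k : Fin 2 → ℤ, freqNormSq k ≠ m → mFourierCoeff (EuclideanSpace.complexify ∘ g) k = 0)
    (hu₀ : MemLp u₀ 2 volume) (hu : IsGlobalLerayHopf ν (fun _ => g) u₀ u) :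
    longTimeAvgSup (fun t => (eGradNormSq (u t)).toReal) ≤ 4 * Real.pi ^ 2 * m * meanEnergy u := by
  obtain ⟨K, hK0, hK⟩ := toReal_eGradNormSq_le_of_singleShell hν hg hm hg1 hu₀ hu
  set Λ : ℝ := 4 * Real.pi ^ 2 * m with hΛ
  have hΛ0 : 0 ≤ Λ := by positivity
  set cc : ℝ := 8 * Real.pi ^ 2 * m * ν with hcc
  have hcc0 : 0 < cc := by positivity
  set C : ℝ := K * Real.exp cc with hC
  have hC0 : 0 ≤ C := by positivity
  -- the observables
  set Z : ℝ → ℝ := fun t => (eGradNormSq (u t)).toReal with hZ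
  set E : ℝ → ℝ := fun t => ∫ x, ‖u t x‖ ^ 2 with hE
  set F : ℝ → ℝ := fun t => Λ * E t + C * Real.exp (-cc * t) with hF
  set G : ℝ → ℝ := (Iio (1 : ℝ)).indicator Z with hG
  have hZ0 : ∀ t, 0 ≤ Z t := fun t => ENNReal.toReal_nonneg
  have hE0 : ∀ t, 0 ≤ E t := fun t => integral_nonneg fun _ => sq_nonneg _
  have hF0 : ∀ t, 0 ≤ F t := fun t => by positivity
  have hG0 : ∀ t, 0 ≤ G t := fun t => Set.indicator_nonneg (fun s _ => hZ0 s) t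
  -- integrability on every `(0, T]`
  have hZi : ∀ T, 0 < T → IntegrableOn Z (Ioc 0 T) := fun T hT => (hu.integrableOn_toReal_eGradNormSq hT).1
  have hEi : ∀ T, 0 < T → IntegrableOn E (Ioc 0 T) := fun T hT => hu.integrableOn_integral_norm_sq hT
  have hexpi : ∀ T, 0 < T → IntegrableOn (fun t => C * Real.exp (-cc * t)) (Ioc 0 T) := fun T hT =>
    (Continuous.integrableOn_Icc (by fun_prop)).mono_set Ioc_subset_Icc_self
  have hFi : ∀ T, 0 < T → IntegrableOn F (Ioc 0 T) := fun T hT => ((hEi T hT).const_mul Λ).add (hexpi T hT)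
  have hGi : ∀ T, 0 < T → IntegrableOn G (Ioc 0 T) := fun T hT => (hZi T hT).indicator measurableSet_Iio
  -- bounded running means
  have hEb : IsBoundedUnder (· ≤ ·) atTop (timeMean E) :=
    isBoundedUnder_of_eventually_le
      (eventually_atTop.2 ⟨1, fun T hT => hu.timeMean_norm_sq_le hν hg hgm hT⟩)
  have hexpb : IsBoundedUnder (· ≤ ·) atTop (timeMean fun t => C * Real.exp (-cc * t)) :=
    isBoundedUnder_of_eventually_le ((eventually_ge_atTop (1 : ℝ)).mono fun T hT =>
      (timeMean_exp_le hC0 hcc0 (one_pos.trans_le hT)).trans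
        (by
          have : T⁻¹ ≤ 1 := inv_le_one_of_one_le₀ hT
          have h' : 0 ≤ C / cc := by positivity
          nlinarith))
  have hΛEb : IsBoundedUnder (· ≤ ·) atTop (timeMean fun t => Λ * E t) := by
    obtain ⟨M, hM⟩ := hEb
    refine ⟨Λ * M, ?_⟩
    rw [Filter.eventually_map] at hM ⊢
    filter_upwards [hM] with T hT
    rw [timeMean_const_mul]
    exact mul_le_mul_of_nonneg_left hT hΛ0
  have hFb : IsBoundedUnder (· ≤ ·) atTop (timeMean F) := by
    obtain ⟨M₁, hM₁⟩ := hΛEb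
    obtain ⟨M₂, hM₂⟩ := hexpb
    refine ⟨M₁ + M₂, ?_⟩
    rw [Filter.eventually_map] at hM₁ hM₂ ⊢
    filter_upwards [hM₁, hM₂, eventually_gt_atTop (0 : ℝ)] with T h1 h2 hT
    have := timeMean_add hT.le ((hEi T hT).const_mul Λ) (hexpi T hT)
    simp only [hF]
    rw [this]
    exact add_le_add h1 h2
  have hGb : IsBoundedUnder (· ≤ ·) atTop (timeMean G) := by
    have h := longTimeAvgSup_indicator_Iio_one_eq_zero hZ0 (hZi 1 one_pos)
    -- bounded since the means tend to zero (they are ≤ D/T ≤ D for T ≥ 1)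
    refine isBoundedUnder_of_eventually_le (a := ∫ t in Ioc 0 1, Z t) ?_
    filter_upwards [eventually_ge_atTop (1 : ℝ)] with T hT
    have hT0 : 0 < T := one_pos.trans_le hT
    unfold timeMean
    rw [intervalIntegral.integral_of_le hT0.le, hG, setIntegral_indicator measurableSet_Iio]
    have hsub : Ioc 0 T ∩ Iio 1 ⊆ Ioc 0 1 := fun t ht => ⟨ht.1.1, le_of_lt ht.2⟩
    have h1 : ∫ t in Ioc 0 T ∩ Iio 1, Z t ≤ ∫ t in Ioc 0 1, Z t :=
      setIntegral_mono_set (hZi 1 one_pos) (ae_of_all _ fun t => hZ0 t) (ae_of_all _ hsub)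
    have hD0 : 0 ≤ ∫ t in Ioc 0 1, Z t := setIntegral_nonneg measurableSet_Ioc fun t _ => hZ0 t
    have : T⁻¹ ≤ 1 := inv_le_one_of_one_le₀ hT
    calc T⁻¹ * ∫ t in Ioc 0 T ∩ Iio 1, Z t ≤ T⁻¹ * ∫ t in Ioc 0 1, Z t :=
          mul_le_mul_of_nonneg_left h1 (inv_nonneg.2 hT0.le)
      _ ≤ 1 * ∫ t in Ioc 0 1, Z t := mul_le_mul_of_nonneg_right this hD0
      _ = _ := one_mul _
  -- the pointwise splitting `Z ≤ F + G` on `(0, ∞)`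
  have hle : ∀ t, 0 < t → Z t ≤ F t + G t := by
    intro t ht
    rcases lt_or_ge t 1 with h1 | h1
    · have hGt : G t = Z t := by simp [hG, Set.indicator_of_mem (show t ∈ Iio (1:ℝ) from h1)]
      rw [hGt]
      linarith [hF0 t]
    · have hGt : G t = 0 := by simp [hG, Set.indicator_of_notMem (show t ∉ Iio (1:ℝ) from not_lt.2 h1)]
      rw [hGt, add_zero]
      have := hK t h1
      simp only [hF, hZ, hE, hC, hcc, hΛ]
      linarith
  -- the long-time averages
  have h1 : longTimeAvgSup Z ≤ longTimeAvgSup F + longTimeAvgSup G :=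
    longTimeAvgSup_le_add_of_le_add hZ0 hF0 hG0 hFi hGi hFb hGb hle
  have h2 : longTimeAvgSup F ≤ longTimeAvgSup (fun t => Λ * E t) + longTimeAvgSup (fun t => C * Real.exp (-cc * t)) :=
    longTimeAvgSup_add_le (fun t => by positivity) (fun t => by positivity)
      (fun T hT => (hEi T hT).const_mul Λ) hexpi hΛEb hexpb
  have h3 : longTimeAvgSup (fun t => Λ * E t) = Λ * meanEnergy u := by
    rw [longTimeAvgSup_const_mul hΛ0, meanEnergy_eq_longTimeAvgSup]
  have h4 : longTimeAvgSup (fun t => C * Real.exp (-cc * t)) = 0 := longTimeAvgSup_exp_eq_zero hC0 hcc0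
  have h5 : longTimeAvgSup G = 0 := longTimeAvgSup_indicator_Iio_one_eq_zero hZ0 (hZi 1 one_pos)
  calc longTimeAvgSup Z ≤ longTimeAvgSup F + longTimeAvgSup G := h1
    _ ≤ (longTimeAvgSup (fun t => Λ * E t) + longTimeAvgSup (fun t => C * Real.exp (-cc * t))) +
          longTimeAvgSup G := add_le_add h2 le_rfl
    _ = Λ * meanEnergy u := by rw [h3, h4, h5]; ring

/-- **`ε ≤ 4π²mν ⟨‖u‖₂²⟩` for every Leray–Hopf solution under a single-shell force** — the
planar dissipation of Kolmogorov-forced 2-D flow at bounded mean energy is `O(ν)`, whatever the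
shell and whatever the (rough, non-symmetric) data (Tran–Shepherd 2002 §4; CTV 2013 §2). [cite: ConstantinTarfuleaVicol2013, §2 (enst)] -/
theorem meanDissipation_le_of_singleShell (hν : 0 < ν) (hg : IsSmooth g) (hgm : HasZeroMean g)
    {m : ℝ} (hm : 0 < m)
    (hg1 : ∀ k : Fin 2 → ℤ, freqNormSq k ≠ m → mFourierCoeff (EuclideanSpace.complexify ∘ g) k = 0)
    (hu₀ : MemLp u₀ 2 volume) (hu : IsGlobalLerayHopf ν (fun _ => g) u₀ u) :
    meanDissipation ν u ≤ ν * (4 * Real.pi ^ 2 * m) * meanEnergy u := by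
  unfold meanDissipation
  rw [longTimeAvgSup_const_mul hν.le, mul_assoc]
  exact mul_le_mul_of_nonneg_left (longTimeAvgSup_enstrophy_le_of_singleShell hν hg hgm hm hg1 hu₀ hu) hν.le

end LongTime

/-! ### Crux form: single-shell witnesses of `TwodBoundedEnergyZeroMomentum` dissipate `O(ν_j)` -/

section Crux

/-- **Single-shell witnesses are dissipation-free in the limit, at rate `ν_j`.** If the crux body of
`TwoAndHalfD.TwodBoundedEnergyZeroMomentum` holds with a force `g` supported on ONE shell
`|k|² = m` (`m > 0`; e.g. any Kolmogorov forcing `sin(2πℓx₂)e₁`, `m = ℓ²`), then along the family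
`ε_j = ⟨ν_j‖∇v_j‖²⟩ ≤ 4π²m E ν_j → 0` and the mean enstrophy is `≤ 4π²mE/1` uniformly in `j`: the
witness carries no anomalous planar dissipation and is `ν`-uniformly bounded in mean `H¹`, so in
the two-and-a-half-dimensional lift all the anomaly must come from the passive third component
(whose source–solution correlation then vanishes by DiPerna–Lions renormalisation — the barrier
file's paper argument; design rule "`g` must span ≥ 2 shells"). [cite: ConstantinTarfuleaVicol2013, §2 (enst)] -/
theorem witness_meanDissipation_le_of_singleShell
    {g : UnitAddTorus (Fin 2) → EuclideanSpace ℝ (Fin 2)} (hg : IsSmooth g) (hgm : HasZeroMean g)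
    {m : ℝ} (hm : 0 < m)
    (hg1 : ∀ k : Fin 2 → ℤ, freqNormSq k ≠ m → mFourierCoeff (EuclideanSpace.complexify ∘ g) k = 0)
    {ν : ℕ → ℝ} {v₀ : ℕ → UnitAddTorus (Fin 2) → EuclideanSpace ℝ (Fin 2)}
    {v : ℕ → ℝ → UnitAddTorus (Fin 2) → EuclideanSpace ℝ (Fin 2)}
    (hν : ∀ j, 0 < ν j) (hv₀ : ∀ j, MemLp (v₀ j) 2 volume)
    (hv : ∀ j, IsGlobalLerayHopf (ν j) (fun _ => g) (v₀ j) (v j)) {E : ℝ}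
    (hE : ∀ j, meanEnergy (v j) ≤ E) (j : ℕ) :
    meanDissipation (ν j) (v j) ≤ 4 * Real.pi ^ 2 * m * E * ν j ∧
      longTimeAvgSup (fun t => (eGradNormSq (v j t)).toReal) ≤ 4 * Real.pi ^ 2 * m * E := by
  have h1 := meanDissipation_le_of_singleShell (hν j) hg hgm hm hg1 (hv₀ j) (hv j)
  have h2 := longTimeAvgSup_enstrophy_le_of_singleShell (hν j) hg hgm hm hg1 (hv₀ j) (hv j)
  have hΛ0 : 0 ≤ 4 * Real.pi ^ 2 * m := by positivity
  refine ⟨h1.trans ?_, h2.trans (mul_le_mul_of_nonneg_left (hE j) hΛ0)⟩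
  have := mul_le_mul_of_nonneg_left (hE j) hΛ0
  have hνj := (hν j).le
  nlinarith

/-- **Vanishing planar dissipation of single-shell witnesses**: with `ν_j → 0`,
`ε_j = meanDissipation (ν j) (v j) → 0`. [folklore] -/
theorem witness_meanDissipation_tendsto_zero_of_singleShell
    {g : UnitAddTorus (Fin 2) → EuclideanSpace ℝ (Fin 2)} (hg : IsSmooth g) (hgm : HasZeroMean g)
    {m : ℝ} (hm : 0 < m)
    (hg1 : ∀ k : Fin 2 → ℤ, freqNormSq k ≠ m → mFourierCoeff (EuclideanSpace.complexify ∘ g) k = 0)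
    {ν : ℕ → ℝ} {v₀ : ℕ → UnitAddTorus (Fin 2) → EuclideanSpace ℝ (Fin 2)}
    {v : ℕ → ℝ → UnitAddTorus (Fin 2) → EuclideanSpace ℝ (Fin 2)}
    (hν : ∀ j, 0 < ν j) (hν0 : Tendsto ν atTop (𝓝 0)) (hv₀ : ∀ j, MemLp (v₀ j) 2 volume)
    (hv : ∀ j, IsGlobalLerayHopf (ν j) (fun _ => g) (v₀ j) (v j)) {E : ℝ}
    (hE : ∀ j, meanEnergy (v j) ≤ E) :
    Tendsto (fun j => meanDissipation (ν j) (v j)) atTop (𝓝 0) := by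
  have hup : Tendsto (fun j => 4 * Real.pi ^ 2 * m * E * ν j) atTop (𝓝 0) := by
    simpa using hν0.const_mul (4 * Real.pi ^ 2 * m * E)
  have hlow : ∀ j, 0 ≤ meanDissipation (ν j) (v j) := fun j => meanDissipation_nonneg (hν j).le _
  exact tendsto_of_tendsto_of_tendsto_of_le_of_le tendsto_const_nhds hup hlow
    fun j => (witness_meanDissipation_le_of_singleShell hg hgm hm hg1 hν hv₀ hv hE j).1

end Crux

end Summit.AnomalousDissipation.AnomalousDissipation.Theorems.TwodBoundedEnergyZeroMomentum.Negative

end
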